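import Summits.KontsevichZagierPeriods.KontsevichZagierPeriods.Theorems.K2SymbolChainsFigureEightIsTwoSmythBaseMaps
import Summits.KontsevichZagierPeriods.KontsevichZagierPeriods.Theorems.K2SymbolChainsFigureEightIsTwoSmythAlgebra

/-!
# `FigureEightIsTwoSmyth`, post-Jensen chain I: the four arcs of `T_A` (helper)

Item stmt-KontsevichZagierPeriods-5203 of route K2SymbolChains. After the Jensen step the
figure-eight side is the band representation
`R_A = [{(t, s, u) | g(t) < −2, 1 < u < L₊(t)²}, 2/((1+t²)(1+s²)u)]`
(`g = 16c⁴ − 20c² + 2`, `c = (1−t²)/(1+t²)`, `L₊ = (g − √(g²−4))/2`; value `π ∫_{T_A} log L₊² dθ`).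
Its base `T_A = {g < −2} = {0 < t² < 1/3} ∪ {t² > 3}` consists of four arcs
(`θ ∈ (0, π/3), (−π/3, 0), (2π/3, π), (−π, −2π/3)`), permuted by `θ ↦ −θ` (`t ↦ −t`) and
`θ ↦ θ − π` (`t ↦ −1/t`), both of which preserve `g`, `L₊` and the weight `2dt/(1+t²)`. Hence

  `[R_A] − 4·[X] ∈ S`,   `X = R_A` restricted to the arc `0 < t < 1/√3`

(`exists_arcRep`), inside any subgroup `S` containing the scissors moves: two base splits (rule 1a)
and two base changes of variables (rule 2, file `…BaseMaps`). [Kontsevich–Zagier 2001, §1.2,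
rules 1)–2)] [folklore]
-/

noncomputable section

open MeasureTheory Set
open Literature.NumberTheory.Transcendental Literature.ModelTheory.ExponentialFields
open Summit.KontsevichZagierPeriods.K2SymbolChains.JensenIsScissorsProof

-- single-conjunct summit: Sub = Summit, so the namespace segment repeats by design (CONVENTIONS §2)
set_option linter.dupNamespace false

namespace Summit.KontsevichZagierPeriods.KontsevichZagierPeriods.Theorems

open Literature.NumberTheory.Transcendental.KZ

variable {S : AddSubgroup FormalRep}

/-! ### Invariance of the data under `t ↦ −t` and `t ↦ −1/t` -/

/-- `c(−1/t)² = c(t)²` (`cos(θ − π)² = cos θ ²`). [folklore] -/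
theorem ratCos_sq_neg_inv {t : ℝ} (ht : t ≠ 0) :
    ((1 - (-t⁻¹) ^ 2) / (1 + (-t⁻¹) ^ 2)) ^ 2 = ((1 - t ^ 2) / (1 + t ^ 2)) ^ 2 := by
  have h1 : (1 + t ^ 2 : ℝ) ≠ 0 := by positivity
  field_simp
  ring

/-- `g(−1/t) = g(t)` for `g = 16c⁴ − 20c² + 2`. [folklore] -/
theorem torusG_neg_inv {t : ℝ} (ht : t ≠ 0) :
    16 * ((1 - (-t⁻¹) ^ 2) / (1 + (-t⁻¹) ^ 2)) ^ 4 - 20 * ((1 - (-t⁻¹) ^ 2) / (1 + (-t⁻¹) ^ 2)) ^ 2 + 2 =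
      16 * ((1 - t ^ 2) / (1 + t ^ 2)) ^ 4 - 20 * ((1 - t ^ 2) / (1 + t ^ 2)) ^ 2 + 2 := by
  have h4 : ∀ x : ℝ, x ^ 4 = (x ^ 2) ^ 2 := fun x => by ring
  rw [h4, h4 ((1 - t ^ 2) / (1 + t ^ 2)), ratCos_sq_neg_inv ht]

/-- `g(−t) = g(t)`. [folklore] -/
theorem torusG_neg (t : ℝ) :
    16 * ((1 - (-t) ^ 2) / (1 + (-t) ^ 2)) ^ 4 - 20 * ((1 - (-t) ^ 2) / (1 + (-t) ^ 2)) ^ 2 + 2 =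
      16 * ((1 - t ^ 2) / (1 + t ^ 2)) ^ 4 - 20 * ((1 - t ^ 2) / (1 + t ^ 2)) ^ 2 + 2 := by
  rw [neg_sq]

/-- The weight transforms correctly under `t ↦ −1/t`: `2/(1+t²) = (2/(1+(1/t)²)) · |1/t²|`.
[folklore] -/
theorem weight_neg_inv {t : ℝ} (ht : t ≠ 0) (s u : ℝ) :
    2 / ((1 + t ^ 2) * (1 + s ^ 2)) / u = 2 / ((1 + (-t⁻¹) ^ 2) * (1 + s ^ 2)) / u * |(t ^ 2)⁻¹| := by
  rw [abs_of_pos (by positivity)]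
  have h1 : (1 + t ^ 2 : ℝ) ≠ 0 := by positivity
  have h2 : (1 + s ^ 2 : ℝ) ≠ 0 := by positivity
  field_simp
  ring

/-! ### The arcs -/

/-- `t² < 1/3 ↔ |t| < 1/√3`. [folklore] -/
theorem sq_lt_third_iff (t : ℝ) : t ^ 2 < 1 / 3 ↔ |t| < (Real.sqrt 3)⁻¹ := by
  rw [← Real.sqrt_inv, Real.lt_sqrt (abs_nonneg t), sq_abs, inv_eq_one_div]

/-- The outer arcs lie in `T_A`: `3 < t² ⇒ g(t) < −2`. [folklore] -/
theorem torusG_lt_of_three_lt_sq {t : ℝ} (ht : 3 < t ^ 2) :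
    16 * ((1 - t ^ 2) / (1 + t ^ 2)) ^ 4 - 20 * ((1 - t ^ 2) / (1 + t ^ 2)) ^ 2 + 2 < -2 :=
  (torusG_lt_neg_two_iff t).2 (Or.inr ht)

/-- **`[R_A] − 4·[X] ∈ S`: reduction of the figure-eight band to the arc `0 < t < 1/√3`.** For
the post-Jensen representation `R_A = [{g(t) < −2, 1 < u < L₊(t)²}, 2/((1+t²)(1+s²)u)]` there is a
representation `X` with domain `{0 < t < 1/√3, 1 < u < L₊(t)²}` and the same integrand such that
`[R_A] − 4·[X] ∈ S`: split the base into `{t² > 3}` and `{0 < t² < 1/3}` (rule 1a), carry the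
former onto the latter by `t ↦ −1/t` (rule 2; `g`, `L₊` and `2dt/(1+t²)` are invariant), split at
`t = 0` and fold `t < 0` onto `t > 0` by `t ↦ −t`. [Kontsevich–Zagier 2001, §1.2, rules 1)–2)]
[folklore] -/
theorem exists_arcRep (hS : domainAddRel ∪ integrandAddRel ∪ changeOfVariablesRel ⊆ S)
    (RA : IntegralRep 3)
    (hRA : RA.domain = {z : Fin 3 → ℝ | Fin.init z ∈ {b : Fin 2 → ℝ |
      16 * ((1 - b 0 ^ 2) / (1 + b 0 ^ 2)) ^ 4 - 20 * ((1 - b 0 ^ 2) / (1 + b 0 ^ 2)) ^ 2 + 2 < -2} ∧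
      1 < z (Fin.last 2) ∧ z (Fin.last 2) <
        ((16 * ((1 - (Fin.init z) 0 ^ 2) / (1 + (Fin.init z) 0 ^ 2)) ^ 4 -
            20 * ((1 - (Fin.init z) 0 ^ 2) / (1 + (Fin.init z) 0 ^ 2)) ^ 2 + 2 -
          Real.sqrt ((16 * ((1 - (Fin.init z) 0 ^ 2) / (1 + (Fin.init z) 0 ^ 2)) ^ 4 -
            20 * ((1 - (Fin.init z) 0 ^ 2) / (1 + (Fin.init z) 0 ^ 2)) ^ 2 + 2) ^ 2 - 4)) / 2) ^ 2})
    (hRAi : EqOn RA.integrand (fun z => 2 / ((1 + (Fin.init z) 0 ^ 2) * (1 + (Fin.init z) 1 ^ 2)) /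
      z (Fin.last 2)) RA.domain) :
    ∃ X : IntegralRep 3, X.domain = {z : Fin 3 → ℝ | Fin.init z ∈ {b : Fin 2 → ℝ | b 0 ∈ Ioo 0 (Real.sqrt 3)⁻¹} ∧
      1 < z (Fin.last 2) ∧ z (Fin.last 2) <
        ((16 * ((1 - (Fin.init z) 0 ^ 2) / (1 + (Fin.init z) 0 ^ 2)) ^ 4 -
            20 * ((1 - (Fin.init z) 0 ^ 2) / (1 + (Fin.init z) 0 ^ 2)) ^ 2 + 2 -
          Real.sqrt ((16 * ((1 - (Fin.init z) 0 ^ 2) / (1 + (Fin.init z) 0 ^ 2)) ^ 4 -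
            20 * ((1 - (Fin.init z) 0 ^ 2) / (1 + (Fin.init z) 0 ^ 2)) ^ 2 + 2) ^ 2 - 4)) / 2) ^ 2} ∧
      EqOn X.integrand (fun z => 2 / ((1 + (Fin.init z) 0 ^ 2) * (1 + (Fin.init z) 1 ^ 2)) /
        z (Fin.last 2)) X.domain ∧
      of RA - 4 • of X ∈ S := by
  -- notation for the fibre bound as a function of the base point
  set q : (Fin 2 → ℝ) → ℝ := fun b =>
    ((16 * ((1 - b 0 ^ 2) / (1 + b 0 ^ 2)) ^ 4 - 20 * ((1 - b 0 ^ 2) / (1 + b 0 ^ 2)) ^ 2 + 2 -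
      Real.sqrt ((16 * ((1 - b 0 ^ 2) / (1 + b 0 ^ 2)) ^ 4 -
        20 * ((1 - b 0 ^ 2) / (1 + b 0 ^ 2)) ^ 2 + 2) ^ 2 - 4)) / 2) ^ 2 with hq_def
  have hq_neg_inv : ∀ t : ℝ, t ≠ 0 → ∀ s : ℝ, q ![-t⁻¹, s] = q ![t, s] := fun t ht s => by
    simp only [hq_def, Matrix.cons_val_zero, torusG_neg_inv ht]
  have hq_neg : ∀ t s : ℝ, q ![-t, s] = q ![t, s] := fun t s => by
    simp only [hq_def, Matrix.cons_val_zero, torusG_neg t]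
  have hq_init : ∀ z : Fin 3 → ℝ, q (Fin.init z) =
      ((16 * ((1 - (Fin.init z) 0 ^ 2) / (1 + (Fin.init z) 0 ^ 2)) ^ 4 -
            20 * ((1 - (Fin.init z) 0 ^ 2) / (1 + (Fin.init z) 0 ^ 2)) ^ 2 + 2 -
          Real.sqrt ((16 * ((1 - (Fin.init z) 0 ^ 2) / (1 + (Fin.init z) 0 ^ 2)) ^ 4 -
            20 * ((1 - (Fin.init z) 0 ^ 2) / (1 + (Fin.init z) 0 ^ 2)) ^ 2 + 2) ^ 2 - 4)) / 2) ^ 2 :=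
    fun z => rfl
  have hq_eq : ∀ b : Fin 2 → ℝ, q b = q ![b 0, b 1] := fun b => by simp only [hq_def, Matrix.cons_val_zero]
  -- the pieces of the base
  set Pout : Set (Fin 2 → ℝ) := {b | (3 : ℝ) < b 0 ^ 2} with hPout_def
  set Q : Set (Fin 2 → ℝ) := {b | (0 : ℝ) < b 0} with hQ_def
  have hPout : IsSemialgebraic ℚ Pout := by simpa using isSemialgebraic_fin_two_sq_gt 3
  have hQ : IsSemialgebraic ℚ Q := by simpa using isSemialgebraic_fin_two_gt 0
  have h3pos : (0 : ℝ) < (Real.sqrt 3)⁻¹ := inv_pos.2 (Real.sqrt_pos.2 (by norm_num))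
  -- first split: outer arcs / inner arcs
  have s₁ := of_sub_restrict_base_mem hS RA hPout
  set RA₁ := RA.restrict (RA.domain ∩ {z | Fin.init z ∈ Pout})
    (RA.isSemialgebraic_domain.inter (isSemialgebraic_cyl hPout)) inter_subset_left with hRA₁
  set RA₂ := RA.restrict (RA.domain \ {z | Fin.init z ∈ Pout})
    (RA.isSemialgebraic_domain.diff (isSemialgebraic_cyl hPout)) sdiff_subset with hRA₂
  have hRA₁d : RA₁.domain = {z : Fin 3 → ℝ | Fin.init z ∈ {b : Fin 2 → ℝ | b 0 ∈ {t : ℝ | 3 < t ^ 2}} ∧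
      1 < z (Fin.last 2) ∧ z (Fin.last 2) < q (Fin.init z)} := by
    rw [hRA₁, IntegralRep.domain_restrict, hRA]
    ext z
    simp only [mem_inter_iff, mem_setOf_eq, hPout_def, hq_init]
    constructor
    · rintro ⟨⟨-, h1, h2⟩, h3⟩; exact ⟨h3, h1, h2⟩
    · rintro ⟨h3, h1, h2⟩; exact ⟨⟨torusG_lt_of_three_lt_sq h3, h1, h2⟩, h3⟩
  have hRA₂d : RA₂.domain = {z : Fin 3 → ℝ | Fin.init z ∈ {b : Fin 2 → ℝ | b 0 ∈ {t : ℝ | t ≠ 0 ∧ t ^ 2 < 1 / 3}} ∧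
      1 < z (Fin.last 2) ∧ z (Fin.last 2) < q (Fin.init z)} := by
    rw [hRA₂, IntegralRep.domain_restrict, hRA]
    ext z
    simp only [mem_sdiff, mem_setOf_eq, hPout_def, hq_init, torusG_lt_neg_two_iff]
    constructor
    · rintro ⟨⟨h | h, h1, h2⟩, h3⟩
      · exact ⟨h, h1, h2⟩
      · exact absurd h h3
    · rintro ⟨h, h1, h2⟩
      exact ⟨⟨Or.inl h, h1, h2⟩, by nlinarith [h.2]⟩
  -- `t ↦ −1/t` carries the outer arcs onto the inner ones
  have e₁ : of RA₁ - of RA₂ ∈ S := by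
    have hI : IsSemialgebraic ℚ {b : Fin 2 → ℝ | b 0 ∈ {t : ℝ | 3 < t ^ 2}} := hPout
    have hφs : IsSemialgebraicFunOn ℚ {b : Fin 2 → ℝ | b 0 ∈ {t : ℝ | 3 < t ^ 2}} (fun b => -(b 0)⁻¹) := by
      have hne : ∀ b ∈ {b : Fin 2 → ℝ | b 0 ∈ {t : ℝ | 3 < t ^ 2}}, b 0 ≠ 0 := fun b hb h => by
        have hb' : (3:ℝ) < b 0 ^ 2 := hb
        rw [h] at hb'
        norm_num at hb'
      exact ((isSemialgebraicFunOn_apply hI 0).inv hne).neg.congr fun b _ => rfl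
    refine of_sub_of_mem_baseMap hS (φ := fun t : ℝ => -t⁻¹) (φ' := fun t : ℝ => (t ^ 2)⁻¹)
      (I := {t : ℝ | 3 < t ^ 2}) (J := {t : ℝ | t ≠ 0 ∧ t ^ 2 < 1 / 3}) hI hφs ?_ ?_ ?_ (q := q) (q' := q)
      ?_ RA₁ RA₂ hRA₁d hRA₂d ?_
    · intro t ht
      have ht0 : t ≠ 0 := by rintro rfl; norm_num at ht
      have h : HasDerivAt (fun y : ℝ => -y⁻¹) (-(-(t ^ 2)⁻¹)) t := (hasDerivAt_inv ht0).neg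
      simpa using h
    · intro t ht t' ht' h
      have ht0 : t ≠ 0 := by rintro rfl; simp at ht; norm_num at ht
      have ht0' : t' ≠ 0 := by rintro rfl; simp at ht'; norm_num at ht'
      simpa using congrArg (fun x : ℝ => -x⁻¹) h
    · ext u
      simp only [mem_image, mem_setOf_eq]
      constructor
      · rintro ⟨t, ht, rfl⟩
        have ht0 : t ≠ 0 := by rintro rfl; norm_num at ht
        refine ⟨by simpa using ht0, ?_⟩
        rw [neg_sq, inv_pow, inv_lt_comm₀ (by positivity) (by norm_num)]
        simpa using ht
      · rintro ⟨hu0, hu⟩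
        refine ⟨-u⁻¹, ?_, by simp⟩
        have hu2 : 0 < u ^ 2 := by positivity
        rw [neg_sq, inv_pow, lt_inv_comm₀ (by norm_num) hu2]
        simpa [one_div] using hu
    · intro b hb
      have hb0 : b 0 ≠ 0 := by
        intro h
        have := hb
        simp [mem_setOf_eq, h] at this
        norm_num at this
      rw [hq_eq b, hq_neg_inv (b 0) hb0 (b 1)]
    · intro z hz
      have hz' := hz
      rw [hRA₁d] at hz'
      have hb0 : (Fin.init z) 0 ≠ 0 := by
        intro h
        have := hz'.1
        simp [h] at this
        norm_num at this
      have hz₂ : (Fin.snoc (![-((Fin.init z) 0)⁻¹, (Fin.init z) 1] : Fin 2 → ℝ) (z (Fin.last 2)) : Fin 3 → ℝ) ∈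
          RA₂.domain := by
        rw [hRA₂d]
        simp only [mem_setOf_eq, Fin.init_snoc, Fin.snoc_last, Matrix.cons_val_zero]
        refine ⟨⟨by simpa using hb0, ?_⟩, hz'.2.1, ?_⟩
        · rw [neg_sq, inv_pow, inv_lt_comm₀ (by positivity) (by norm_num)]
          simpa using hz'.1
        · rw [hq_neg_inv _ hb0, ← hq_eq]
          exact hz'.2.2
      rw [hRA₁, IntegralRep.integrand_restrict, hRAi hz.1, hRA₂, IntegralRep.integrand_restrict, hRAi hz₂.1]
      simp only [Fin.init_snoc, Fin.snoc_last, Matrix.cons_val_zero, Matrix.cons_val_one]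
      exact weight_neg_inv hb0 _ _
  -- second split: `t > 0` / `t < 0`
  have s₂ := of_sub_restrict_base_mem hS RA₂ hQ
  set RA₃ := RA₂.restrict (RA₂.domain ∩ {z | Fin.init z ∈ Q})
    (RA₂.isSemialgebraic_domain.inter (isSemialgebraic_cyl hQ)) inter_subset_left with hRA₃
  set RA₄ := RA₂.restrict (RA₂.domain \ {z | Fin.init z ∈ Q})
    (RA₂.isSemialgebraic_domain.diff (isSemialgebraic_cyl hQ)) sdiff_subset with hRA₄
  have hRA₃d : RA₃.domain = {z : Fin 3 → ℝ | Fin.init z ∈ {b : Fin 2 → ℝ | b 0 ∈ Ioo 0 (Real.sqrt 3)⁻¹} ∧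
      1 < z (Fin.last 2) ∧ z (Fin.last 2) < q (Fin.init z)} := by
    rw [hRA₃, IntegralRep.domain_restrict, hRA₂d]
    ext z
    simp only [mem_inter_iff, mem_setOf_eq, hQ_def, mem_Ioo, sq_lt_third_iff]
    constructor
    · rintro ⟨⟨⟨-, h⟩, h1, h2⟩, h3⟩
      exact ⟨⟨h3, (abs_lt.1 h).2⟩, h1, h2⟩
    · rintro ⟨⟨h3, h⟩, h1, h2⟩
      exact ⟨⟨⟨h3.ne', abs_lt.2 ⟨by linarith, h⟩⟩, h1, h2⟩, h3⟩
  have hRA₄d : RA₄.domain = {z : Fin 3 → ℝ | Fin.init z ∈ {b : Fin 2 → ℝ | b 0 ∈ Ioo (-(Real.sqrt 3)⁻¹) 0} ∧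
      1 < z (Fin.last 2) ∧ z (Fin.last 2) < q (Fin.init z)} := by
    rw [hRA₄, IntegralRep.domain_restrict, hRA₂d]
    ext z
    simp only [mem_sdiff, mem_setOf_eq, hQ_def, mem_Ioo, sq_lt_third_iff, not_lt]
    constructor
    · rintro ⟨⟨⟨h0, h⟩, h1, h2⟩, h3⟩
      exact ⟨⟨(abs_lt.1 h).1, lt_of_le_of_ne h3 h0⟩, h1, h2⟩
    · rintro ⟨⟨h, h3⟩, h1, h2⟩
      exact ⟨⟨⟨h3.ne, abs_lt.2 ⟨h, by linarith⟩⟩, h1, h2⟩, h3.le⟩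
  -- `t ↦ −t` carries `t < 0` onto `t > 0`
  have e₂ : of RA₄ - of RA₃ ∈ S := by
    have hI : IsSemialgebraic ℚ {b : Fin 2 → ℝ | b 0 ∈ Ioo (-(Real.sqrt 3)⁻¹) 0} := by
      have h := (isSemialgebraic_fin_two_lt 0).inter (isSemialgebraic_fin_two_sq_lt (1 / 3))
      convert h using 1
      ext b
      simp only [mem_setOf_eq, mem_Ioo, mem_inter_iff, Rat.cast_zero, Rat.cast_div, Rat.cast_one,
        Rat.cast_ofNat, sq_lt_third_iff]
      constructor
      · rintro ⟨h, h0⟩; exact ⟨h0, abs_lt.2 ⟨h, by linarith⟩⟩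
      · rintro ⟨h0, h⟩; exact ⟨(abs_lt.1 h).1, h0⟩
    have hφs : IsSemialgebraicFunOn ℚ {b : Fin 2 → ℝ | b 0 ∈ Ioo (-(Real.sqrt 3)⁻¹) 0} (fun b => -(b 0)) :=
      (isSemialgebraicFunOn_apply hI 0).neg
    refine of_sub_of_mem_baseMap hS (φ := fun t : ℝ => -t) (φ' := fun _ : ℝ => (-1 : ℝ))
      (I := Ioo (-(Real.sqrt 3)⁻¹) 0) (J := Ioo 0 (Real.sqrt 3)⁻¹) hI hφs
      (fun t _ => by simpa using (hasDerivAt_neg t)) (fun t _ t' _ h => neg_injective h) ?_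
      (q := q) (q' := q) (fun b _ => by rw [hq_eq b, hq_neg]) RA₄ RA₃ hRA₄d hRA₃d ?_
    · simp
    · intro z hz
      have hz' := hz
      rw [hRA₄d] at hz'
      have hz₃ : (Fin.snoc (![-((Fin.init z) 0), (Fin.init z) 1] : Fin 2 → ℝ) (z (Fin.last 2)) : Fin 3 → ℝ) ∈
          RA₃.domain := by
        rw [hRA₃d]
        simp only [mem_setOf_eq, Fin.init_snoc, Fin.snoc_last, Matrix.cons_val_zero, mem_Ioo]
        refine ⟨⟨by linarith [hz'.1.2], by linarith [hz'.1.1]⟩, hz'.2.1, ?_⟩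
        rw [hq_neg, ← hq_eq]
        exact hz'.2.2
      rw [hRA₄, IntegralRep.integrand_restrict, hRA₂, IntegralRep.integrand_restrict, hRAi hz.1.1,
        hRA₃, IntegralRep.integrand_restrict]
      rw [hRA₃, IntegralRep.domain_restrict] at hz₃
      rw [hRA₂, IntegralRep.integrand_restrict, hRAi hz₃.1.1]
      simp only [Fin.init_snoc, Fin.snoc_last, Matrix.cons_val_zero, Matrix.cons_val_one,
        neg_sq, abs_neg, abs_one, mul_one]
  -- assemble
  refine ⟨RA₃, hRA₃d, fun z hz => ?_, ?_⟩
  · rw [hRA₃, IntegralRep.integrand_restrict, hRA₂, IntegralRep.integrand_restrict]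
    rw [hRA₃, IntegralRep.domain_restrict] at hz
    exact hRAi hz.1.1
  · have : of RA - 4 • of RA₃ = (of RA - of RA₁ - of RA₂) + (of RA₁ - of RA₂) +
        2 • (of RA₂ - of RA₃ - of RA₄) + 2 • (of RA₄ - of RA₃) := by
      simp only [smul_sub]
      abel
    rw [this]
    exact S.add_mem (S.add_mem (S.add_mem s₁ e₁) (S.nsmul_mem s₂ 2)) (S.nsmul_mem e₂ 2)

end Summit.KontsevichZagierPeriods.KontsevichZagierPeriods.Theorems
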